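import Summits.PneNP.PneNP.Theorems.PhaseTwinsPseudorandomTwinsAboveConflictGraphFn
import Summits.PneNP.PneNP.Theorems.PhaseTwinsPseudorandomTwinsAboveConflictGraphGap
import Literature.Computability.Complexity.HardcoreInapproximability
import Literature.Computability.Complexity.FPRASTransfer
import Literature.Computability.Complexity.CountingHierarchyProofs
import Literature.Computability.Complexity.LengthCompare
import Literature.Computability.Complexity.CoinCounting
import Literature.Computability.Complexity.TM2PassThrough
import Literature.Computability.Complexity.ProbabilisticClasses
import Literature.Computability.Complexity.HamCircuitNP

/-!
# The fact-free corner of crux stmt-PneNP-2717: FPRASes for the hard-core count everywhere above the threshold give `NP ⊆ BPP`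

Line `SketchIdeator1` for the crux `Summit.PneNP.PneNP.Theses.PhaseTwins.NoFBPPApproxAboveUniqueness`
(route PneNP/PhaseTwins), stub `stub_factFreeAssembly` (the lead's assembly step of the corner), stated with its
two machine-level ingredients as HYPOTHESES (both LANDED theorems):

* `hdec` = `stub_fprasDecider` (`Theorems/PhaseTwinsNoFBPPApproxAboveUniquenessFprasDecider.lean`): the one-bit
  map `⟨y, u⟩ ↦ [K·|hdr y| ≤ |⌜E⌝|]`, `E` the FPRAS estimate on `f₁ y` at accuracy `1`, confidence `4`, coins
  `u ↾ c(|f₁ y| + 5)`, is in `FP`;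
* `hgap` = `Summit.PneNP.PneNP.Theorems.stub_gapE3SATB` (`Theorems/PhaseTwinsPseudorandomTwinsAboveGapE3SATB.lean`,
  line of crux stmt-PneNP-2721): bounded-occurrence gap-E3SAT is NP-hard (Karp), from the tree's PROVED PCP
  theorem;

and, imported, the conflict-graph code in `FP` (`Theorems.stub_conflictGraphFn`) and the counting window
(`Theorems.ConflictGraphGap.window`, `threshold_lt`) of the same line.

**Theorem** (`stub_factFreeAssembly`): if `hardcoreCount Δ p q` has an FPRAS (`HasFPRAS`) at every admissible
`(Δ, p, q)` (`Δ ≥ 3`, `q > 0`, `λ_c(Δ) < p/q`) then `NP ⊆ BPP`. Proof: for `L ∈ NP` take `g, γ, B` from `hgap`,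
`K` with `K ≥ B + 3`, `Kγ ≥ 6`, the FPRAS `F, c` at the admissible corner `(B+3, 2^K, 1)` (`threshold_lt`), and
`x := f (g y)` the code of the conflict graph of the E3-CNF `φ` coded by `g y` (`m` clauses, `1^m` = header of the
CNF code). By the window, `y ∈ L ⇒ N(x) ≥ 2^{Km}` and `y ∉ L ⇒ 0 < N(x) ≤ 2^{Km-3}` (`m ≥ 1` in the second case
because `maxSatFraction [] = 1`). For the `≥ 3/4` fraction of coin strings on which `E ∈ [N/2, 2N]`:
YES gives `E ≥ 2^{Km-1}`, i.e. `size E ≥ Km`; NO gives `E ≤ 2^{Km-2} < 2^{Km-1}`, i.e. `size E ≤ Km - 1`; and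
`|⌜E⌝| = size E` (`TM2Pass.length_encodeNat_eq_size`). So the decider errs with probability `≤ 1/4 ≤ 1/3` on every
input: `L ∈ bp P = BPP`.

This replaces the vendored named fact GŠV16 Thm 1 (`NP_eq_RP_of_hardcoreFPRAS`) in the crux's calibration
`NoFBPPApproxAboveUniqueness ⟺ ¬(NP ⊆ BPP)`: a weaker statement (FPRASes at all admissible points, not at one)
but PROVED, and exactly what the calibration consumes.

## References

* M. Luby, E. Vigoda / A. Sly, *Computational transition at the uniqueness threshold*, FOCS 2010, §1 (the
  zero-temperature limit: approximating `Z_G(λ)` for large `λ` approximates the maximum independent set)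
  [Sly2010].
* S. Arora, B. Barak, *Computational Complexity: A Modern Approach*, CUP 2009, Def. 7.3 (`BPP`), Thm. 11.9 /
  §11.3 (PCP, gap problems) [AroraBarak2009].
-/

set_option linter.dupNamespace false

namespace Summit.PneNP.PneNP.Theorems.NoFBPPApproxAboveUniqueness

open Literature.Computability.Complexity Literature.Probability.LatticeModels
open _root_.Computability Polynomial Brick Finset
open Summit.PneNP.PneNP.Theorems (stub_conflictGraphFn)

/-- Parameters: for `γ > 0` and `B` there is `K ≥ B + 3` with `K γ ≥ 6`. [folklore] -/
theorem exists_K (B : ℕ) {γ : ℚ} (hγ : 0 < γ) : ∃ K : ℕ, B + 3 ≤ K ∧ (6 : ℚ) ≤ K * γ := by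
  refine ⟨max ⌈(6 : ℚ) / γ⌉₊ (B + 3), le_max_right _ _, ?_⟩
  have h1 : (6 : ℚ) / γ ≤ (max ⌈(6 : ℚ) / γ⌉₊ (B + 3) : ℕ) :=
    (Nat.le_ceil _).trans (by exact_mod_cast le_max_left _ _)
  rwa [div_le_iff₀ hγ] at h1

/-- The unary header of a CNF code has one symbol per clause. [folklore] -/
theorem length_fstF_encodingCNF (φ : CNF ℕ) : (fstF (encodingCNF.encode φ)).length = φ.length := by
  show (fstF (boolPair (unaryEncodeNat φ.length) _)).length = φ.length
  rw [fstF_boolPair, APTransfer.length_unary]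

/-- **YES-side arithmetic**: `N ≥ 8 · 2^{T-3}`, `3 ≤ T` and a factor-2 estimate `E` of `N` give
`T ≤ size E`. [folklore] -/
theorem size_ge_of_yes {N E T : ℕ} (hT : 3 ≤ T) (hN : 8 * 2 ^ (T - 3) ≤ N) (hE : IsApproxCount 1 N E) :
    T ≤ Nat.size E := by
  obtain ⟨hlo, -⟩ := hE
  have hNE : N ≤ 2 * E := by
    have h : (N : ℝ) ≤ 2 * E := by
      rw [Nat.cast_one, show (1 : ℝ) + 1 / 1 = 2 by norm_num, div_le_iff₀ (by norm_num)] at hlo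
      linarith
    exact_mod_cast h
  have h8 : 8 * 2 ^ (T - 3) = 2 * 2 ^ (T - 1) := by
    rw [show T - 1 = (T - 3) + 2 by omega, pow_add]
    ring
  have hpos : 0 < 2 ^ (T - 3) := Nat.pow_pos (by norm_num)
  have hE' : 2 ^ (T - 1) ≤ E := by
    rw [h8] at hN
    have h4 : 2 ^ (T - 1) = 4 * 2 ^ (T - 3) := by
      rw [show T - 1 = (T - 3) + 2 by omega, pow_add]
      ring
    rw [h4] at hN ⊢
    linarith
  have := Nat.lt_size.2 hE'
  omega

/-- **NO-side arithmetic**: `N ≤ 2^{T-3}`, `3 ≤ T` and a factor-2 estimate `E` of `N` give `size E < T`.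
[folklore] -/
theorem size_lt_of_no {N E T : ℕ} (hT : 3 ≤ T) (hN : N ≤ 2 ^ (T - 3)) (hE : IsApproxCount 1 N E) :
    Nat.size E < T := by
  obtain ⟨-, hhi⟩ := hE
  have hEN : E ≤ 2 * N := by
    have h : (E : ℝ) ≤ 2 * N := by
      rw [Nat.cast_one, show (1 : ℝ) + 1 / 1 = 2 by norm_num] at hhi
      exact hhi
    exact_mod_cast h
  have hpos : 0 < 2 ^ (T - 3) := Nat.pow_pos (by norm_num)
  have h4 : 2 ^ (T - 1) = 4 * 2 ^ (T - 3) := by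
    rw [show T - 1 = (T - 3) + 2 by omega, pow_add]
    ring
  have hE' : E < 2 ^ (T - 1) := by
    rw [h4]
    linarith
  have := Nat.size_le.2 hE'
  omega

/-- **Stub FF3 (lead) — the fact-free corner, assembly.** If the hard-core count has an FPRAS at every
admissible `(Δ, p, q)` then `NP ⊆ BPP`, given the FPRAS-driven decider (`hdec`, landed stub FF2) and the
bounded-occurrence gap-E3SAT hardness (`hgap`, landed `Theorems.stub_gapE3SATB`); see the module docstring.
[cite: Sly2010, §1 (zero-temperature limit)] -/
theorem stub_factFreeAssembly
    (hdec : ∀ {f₁ hdr F : List Bool → List Bool}, f₁ ∈ FP → hdr ∈ FP → F ∈ FP →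
      ∀ (c : Polynomial ℕ) (K : ℕ),
      ∃ D ∈ FP, (∀ w, D w = [true] ∨ D w = [false]) ∧ ∀ y u : List Bool,
        D (boolPair y u) = [decide (K * (hdr y).length ≤
          (encodeNat (countEstimate F (f₁ y) 0 1 4 (u.take (c.eval ((f₁ y).length + 1 + 4))))).length)])
    (hgap : ∀ L : Language Bool, L ∈ Nondeterministic.NP →
      ∃ (g : List Bool → List Bool) (γ : ℚ) (B : ℕ), g ∈ FP ∧ 0 < γ ∧
        ∀ y : List Bool, ∃ φ : CNF ℕ, g y = encodingCNF.encode φ ∧ φ.IsExactWidth 3 ∧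
          (∀ v : ℕ, (φ.countP fun cl => v ∈ cl.map Prod.fst) ≤ B) ∧
          (y ∈ L → φ.Satisfiable) ∧ (y ∉ L → φ.maxSatFraction ≤ 1 - γ))
    (hall : ∀ Δ p q : ℕ, 3 ≤ Δ → 0 < q → hardCoreThreshold Δ < (p : ℝ) / q → HasFPRAS (hardcoreCount Δ p q)) :
    Nondeterministic.NP ⊆ BPP := by
  intro L hL
  obtain ⟨g, γ, B, hg, hγ, hspec⟩ := hgap L hL
  obtain ⟨K, hKB, hK6⟩ := exists_K B hγ
  have hK3 : 3 ≤ K := by omega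
  -- the FPRAS at the admissible corner `(B+3, 2^K, 1)`
  obtain ⟨F, hF, c, hc⟩ := hall (B + 3) (2 ^ K) 1 (by omega) Nat.one_pos (ConflictGraphGap.threshold_lt B K hKB)
  -- the conflict-graph code map and the decider
  obtain ⟨f, hf, hfspec⟩ := stub_conflictGraphFn
  obtain ⟨D, hD, hD1, hDval⟩ := hdec (comp_mem_FP hf hg) (comp_mem_FP fstF_mem_FP hg) hF c K
  obtain ⟨s, hs⟩ := exists_poly_length_le_of_mem_FP (comp_mem_FP hf hg)
  -- `L ∈ bp P`
  refine ⟨{w | D w = [true]}, ?_, c.comp (s + 5), fun y => ?_⟩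
  · exact mem_P_of_mem_FP hD _ fun w => ⟨fun h => h, fun h => (hD1 w).resolve_left h⟩
  -- the instance
  obtain ⟨φ, hgy, h3, hBocc, hyes, hno⟩ := hspec y
  set x := (f ∘ g) y with hx
  set Gc : SimpleGraph (Fin (KarpClique.annot 0 φ).length) :=
    SimpleGraph.fromRel fun p q : Fin (KarpClique.annot 0 φ).length =>
      ((KarpClique.annot 0 φ)[p].1 = (KarpClique.annot 0 φ)[q].1 ∧
          (KarpClique.annot 0 φ)[p].2.1 ≠ (KarpClique.annot 0 φ)[q].2.1) ∨
      ((KarpClique.annot 0 φ)[p].2.1 = (KarpClique.annot 0 φ)[q].2.1 ∧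
          (KarpClique.annot 0 φ)[p].2.2 ≠ (KarpClique.annot 0 φ)[q].2.2) with hGc
  have hxcode : x = encodingGraph.encode ⟨(KarpClique.annot 0 φ).length, Gc⟩ := by
    rw [hx, Function.comp_apply, hgy, hfspec φ]
  have hadj : ∀ p q : Fin (KarpClique.annot 0 φ).length, Gc.Adj p q ↔ p ≠ q ∧
      (((KarpClique.annot 0 φ)[p].1 = (KarpClique.annot 0 φ)[q].1 ∧
          (KarpClique.annot 0 φ)[p].2.1 ≠ (KarpClique.annot 0 φ)[q].2.1) ∨
        ((KarpClique.annot 0 φ)[p].2.1 = (KarpClique.annot 0 φ)[q].2.1 ∧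
          (KarpClique.annot 0 φ)[p].2.2 ≠ (KarpClique.annot 0 φ)[q].2.2)) := by
    intro p q
    rw [hGc, SimpleGraph.fromRel_adj]
    refine and_congr_right fun _ => ⟨fun h => h.elim id fun h' => ?_, Or.inl⟩
    exact h'.elim (fun h1 => Or.inl ⟨h1.1.symm, fun e => h1.2 e.symm⟩)
      (fun h1 => Or.inr ⟨h1.1.symm, fun e => h1.2 e.symm⟩)
  have hwin := ConflictGraphGap.window B γ K hK6 hK3 φ h3 hBocc
  -- names
  set m := φ.length with hm
  set N := hardcoreCount (B + 3) (2 ^ K) 1 x with hN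
  set ℓ := c.eval (x.length + 1 + 4) with hℓ
  set T := (c.comp (s + 5)).eval y.length with hT
  have hhdr : ((fstF ∘ g) y).length = m := by
    rw [Function.comp_apply, hgy, length_fstF_encodingCNF]
  have hℓT : ℓ ≤ T := by
    rw [hℓ, hT, eval_comp, eval_add]
    exact TM2Iter.eval_mono c (by have := hs y; rw [← hx] at this; simp; omega)
  -- the bad event has probability `≤ 1/4`
  have hbad : uniformProb T {u | ¬ IsApproxCount 1 N (countEstimate F x 0 1 4 (u.take ℓ))} ≤ 1 / 4 := by
    have h := hc x 1 4 Nat.one_pos (by norm_num)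
    have h' := APTransfer.uniformProb_take_le_of_le hℓT
      {u' | ¬ IsApproxCount 1 N (countEstimate F x 0 1 4 u')} h
    norm_num at h' ⊢
    exact h'
  -- on the good event the verdict is right
  have hcorrect : ∀ u : List Bool, u.length = T →
      u ∈ ({u | ¬ IsApproxCount 1 N (countEstimate F x 0 1 4 (u.take ℓ))} : Set (List Bool))ᶜ →
        u ∈ {u : List Bool | boolPair y u ∈ ({w | D w = [true]} : Language Bool) ↔ y ∈ L} := by
    intro u _ hgoodu
    have happrox : IsApproxCount 1 N (countEstimate F x 0 1 4 (u.take ℓ)) := by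
      simpa using hgoodu
    show D (boolPair y u) = [true] ↔ y ∈ L
    rw [hDval y u, hhdr, HamNP.singleton_decide_eq_true_iff, TM2Pass.length_encodeNat_eq_size]
    change K * m ≤ Nat.size (countEstimate F x 0 1 4 (u.take ℓ)) ↔ y ∈ L
    by_cases hy : y ∈ L
    · simp only [hy, iff_true]
      rcases Nat.eq_zero_or_pos m with hm0 | hmpos
      · rw [hm0, Nat.mul_zero]; exact Nat.zero_le _
      · have hyes' := (hwin hmpos Gc hadj).1 (hyes hy)
        rw [← hxcode] at hyes'
        exact size_ge_of_yes (le_trans hK3 (Nat.le_mul_of_pos_right K hmpos)) hyes' happrox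
    · simp only [hy, iff_false, not_le]
      have hmpos : 0 < m := by
        rcases Nat.eq_zero_or_pos m with hm0 | hmpos
        · exfalso
          have hφ : φ = [] := List.eq_nil_of_length_eq_zero (by rw [← hm]; exact hm0)
          have := hno hy
          rw [hφ, CNF.maxSatFraction_nil] at this
          linarith
        · exact hmpos
      obtain ⟨-, hNle⟩ := (hwin hmpos Gc hadj).2 (hno hy)
      rw [← hxcode] at hNle
      exact size_lt_of_no (le_trans hK3 (Nat.le_mul_of_pos_right K hmpos)) hNle happrox
  -- probability bookkeeping
  have hcompl := uniformProb_compl T {u | ¬ IsApproxCount 1 N (countEstimate F x 0 1 4 (u.take ℓ))}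
  calc (2 : ℝ) / 3 ≤ 1 - 1 / 4 := by norm_num
    _ ≤ 1 - uniformProb T {u | ¬ IsApproxCount 1 N (countEstimate F x 0 1 4 (u.take ℓ))} := by linarith
    _ = uniformProb T ({u | ¬ IsApproxCount 1 N (countEstimate F x 0 1 4 (u.take ℓ))}ᶜ) := hcompl.symm
    _ ≤ uniformProb T {u : List Bool | boolPair y u ∈ ({w | D w = [true]} : Language Bool) ↔ y ∈ L} :=
        APTransfer.uniformProb_mono_len hcorrect

end Summit.PneNP.PneNP.Theorems.NoFBPPApproxAboveUniqueness
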